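import Mathlib
import HarnessLib
import Summits.ValiantsHypothesis.ValiantsHypothesis.Theorems.MonotoneRestorationOrbitRestorationQPSmlAffinePermanent
import Summits.ValiantsHypothesis.ValiantsHypothesis.Theorems.MonotoneRestorationOrbitRestorationQPSmlAffineDeltaWitness

/-!
# Affine column-set-multilinear `ΣΠΣ` lower bounds for the SUB-PERMANENT SUMS (partial-matching polynomials), by symmetry
(crux `OrbitRestorationQP`, stmt-ValiantsHypothesis-18293 — lane SML of stub A_∞; repair-census item (R3) of hands g8/g9:
"Δ-witness lower bounds for other matrix-symmetric column-multilinear targets (sub-permanent sums)")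

Namespace `Summit.ValiantsHypothesis.ValiantsHypothesis.Theorems.SmlAffinePermanent`.  Definition-free.

The Δ-witness engine `affineColSml_lower_bound_of_deltaWitness` (`…SmlAffineDeltaWitness.lean`) turns a non-vanishing
disjoint-pair difference derivative of (a homogeneous component of) the symmetric shadow `rename fst F` of a row- and
column-symmetric affine column-sml expression `F = Σ_{t<s} Π_b (β_{t,b} + Σ_a α_{t,b,a} x_{(a,b)})` into the lower bound
`s ≥ C(n-j, j)`.  `…SmlAffinePermanent.lean` runs it on the permanent (shadow `n!·y_1⋯y_n`).  Here the target is the ORDERED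
PARTIAL-MATCHING POLYNOMIAL OF ORDER `m`,

  `M_{n,m} := Σ_{g, h : Fin m ↪ Fin n} Π_{i<m} x_{(g i, h i)}  =  m! · Σ_{|I|=|J|=m} per (X_{I,J})`

(`m!` times the sub-permanent sum of order `m`; the subgraph polynomial of the matching `m·K₂` up to the factor `m!`; `M_{n,n} =
n!·per_n`).  It is matrix-symmetric (`rename_perm_embSum₂`), its shadow is `rename fst M_{n,m} = |Fin m ↪ Fin n| · S_{n,m}` with
`S_{n,m} := Σ_{g : Fin m ↪ Fin n} Π_i y_{g i} = m!·e_m(y)` (`rename_fst_embSum₂`), and the Δ-WITNESS is: for `j` disjoint pairs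
`(a i, b i)` and a set `Z` of `m - 2j` further coordinates, `Δ_{a,b} S_{n,m}` evaluated at the indicator of `im a ∪ Z` equals
`(-1)^j · #{g : im g = im a ∪ im b ∪ Z} ≠ 0` (`deltaFold_embSum_ne_zero`; in the bool-expansion of `Δ` only the summand `∂_b`
survives, by a support count).  Hence:

* `pderivFold_prod_X_eq_ite`, `eval_indicator_prod_X` — iterated partials / `0/1`-evaluation of square-free monomials;
* `eval_deltaFold_prod_X` — the per-monomial evaluation `(-1)^j·[U = im a ∪ im b ∪ Z]` for `|U| = m = 2j + |Z|`;
* `deltaFold_embSum_ne_zero` (the witness), `rename_perm_embSum₂`, `rename_fst_embSum₂`, `isHomogeneous_embSum`;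
* `subPermanent_affineColSml_lower_bound` — **every affine column-set-multilinear depth-three expression of `M_{n,m}`
  (`2j ≤ m ≤ n`) has at least `C(n-j, j)` product gates**: `n^{Ω(m)}` for `m ≤ n^{1-ε}`-ish orders, `2^{Ω(n)}` for linear orders,
  super-polynomial as soon as `m` is super-constant — although for `m ≤ polylog n` the family is quasi-polynomially sparse and
  hence orbit-restorable (`qpOrbitRestorable_of_qpSparse`): the poly-budget affine-sml stratum does not exhaust the restorable
  matrix-symmetric families (calibration of lane SML, as asked by the census).

Honest label: a restricted-model lower bound (calibration of the landed stratum); nothing here bears on general `ΣΠΣ`, on the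
registered stubs, or on VP ≠ VNP. [folklore; cf. NisanWigderson1996 (partial-derivative method)]
-/

noncomputable section

open scoped Classical

-- `Summit.ValiantsHypothesis.ValiantsHypothesis.…` is the tree's single-conjunct layout (Sub = Summit).
set_option linter.dupNamespace false

namespace Summit.ValiantsHypothesis.ValiantsHypothesis.Theorems.SmlAffinePermanent

open MvPolynomial Finset Equiv SmlDeltaCalculus SmlFlattening SmlAffineNarrow

/-! ### Iterated partials of a square-free monomial, general position of the tuple -/

/-- **Iterated partials of `Π_{k∈U} y_k` along an injective tuple `c`**: the product over `U ∖ im c` if every `c i` lies in `U`,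
and `0` otherwise. [folklore] -/
theorem pderivFold_prod_X_eq_ite {σ : Type*} [DecidableEq σ] :
    ∀ (j : ℕ) (c : Fin j → σ), Function.Injective c → ∀ U : Finset σ,
      List.foldl (fun (q : MvPolynomial σ ℂ) i => pderiv (c i) q) (∏ k ∈ U, X k) (List.finRange j) =
        if ∀ i, c i ∈ U then ∏ k ∈ U \ Finset.univ.image c, X k else 0 := by
  intro j
  induction j with
  | zero => intro c _ U; simp
  | succ j ih =>
    intro c hc U
    rw [List.finRange_succ, List.foldl_cons, List.foldl_map]
    by_cases h0 : c 0 ∈ U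
    · rw [pderiv_prod_X_of_mem h0]
      rw [show (List.foldl (fun (q : MvPolynomial σ ℂ) i => pderiv (c i.succ) q) (∏ k ∈ U.erase (c 0), X k)
          (List.finRange j)) = List.foldl (fun (q : MvPolynomial σ ℂ) i => pderiv ((fun i => c i.succ) i) q)
          (∏ k ∈ U.erase (c 0), X k) (List.finRange j) from rfl,
        ih (fun i => c i.succ) (hc.comp (Fin.succ_injective j)) (U.erase (c 0))]
      by_cases hall : ∀ i, c i ∈ U
      · rw [if_pos hall, if_pos (fun i => Finset.mem_erase.2 ⟨fun h => Fin.succ_ne_zero i (hc h), hall i.succ⟩)]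
        congr 1
        ext k
        simp only [Finset.mem_sdiff, Finset.mem_erase, Finset.mem_image, Finset.mem_univ, true_and, not_exists]
        constructor
        · rintro ⟨⟨hne, hkU⟩, hno⟩
          exact ⟨hkU, fun i => Fin.cases (Ne.symm hne) (fun i => hno i) i⟩
        · rintro ⟨hkU, hno⟩
          exact ⟨⟨fun h => hno 0 h.symm, hkU⟩, fun i => hno i.succ⟩
      · rw [if_neg hall, if_neg]
        intro h
        apply hall
        intro i
        refine Fin.cases h0 (fun i => ?_) i
        exact (Finset.mem_erase.1 (h i)).2
    · have hz : pderiv (c 0) (∏ k ∈ U, (X k : MvPolynomial σ ℂ)) = 0 :=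
        pderiv_prod_eq_zero _ _ _ (fun k hk => pderiv_X_of_ne (by rintro rfl; exact h0 hk))
      rw [hz, if_neg (fun h => h0 (h 0))]
      have h := pderivFoldList_zsmul (σ := σ) (fun i : Fin j => c i.succ) (List.finRange j) 0 0
      simpa using h

/-- **A square-free monomial at a `0/1` point**: `Π_{k∈W} y_k` evaluated at the indicator of `T` is `[W ⊆ T]`. [folklore] -/
theorem eval_indicator_prod_X {σ : Type*} (W T : Finset σ) (v : σ → ℂ) (h1 : ∀ k ∈ T, v k = 1)
    (h0 : ∀ k ∉ T, v k = 0) :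
    MvPolynomial.eval v (∏ k ∈ W, (X k : MvPolynomial σ ℂ)) = if W ⊆ T then 1 else 0 := by
  rw [map_prod]
  simp only [eval_X]
  by_cases hWT : W ⊆ T
  · rw [if_pos hWT]
    exact Finset.prod_eq_one fun k hk => h1 k (hWT hk)
  · rw [if_neg hWT]
    obtain ⟨k, hkW, hkT⟩ := Finset.not_subset.1 hWT
    exact Finset.prod_eq_zero hkW (h0 k hkT)

/-! ### The per-monomial evaluation of the difference derivative -/

/-- **Per-monomial evaluation.**  For `j` disjoint pairs `(a i, b i)`, a set `Z` avoiding `im a`, and a support `U` of size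
`m = 2j + |Z|`: `Δ_{a,b} (Π_{k∈U} y_k)` evaluated at the indicator of `im a ∪ Z` is `(-1)^j · [U = im a ∪ im b ∪ Z]` — in the
bool-expansion `Δ = Σ_ε ± ∂_{c_ε}` (`c_ε i = b i` if `ε i`, else `a i`) a surviving monomial `Π_{U ∖ im c_ε} y_k` has the
`j + |Z|` elements of `U ∖ im c_ε` inside `im a ∪ Z`, so `U ∖ im c_ε = im a ∪ Z`, which forces `c_ε = b`. [folklore] -/
theorem eval_deltaFold_prod_X {n j m : ℕ} (a b : Fin j → Fin n) (ha : Function.Injective a)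
    (hb : Function.Injective b) (hab : ∀ i i', a i ≠ b i') (Z : Finset (Fin n)) (hZa : ∀ i, a i ∉ Z)
    (hm : 2 * j + Z.card = m) (U : Finset (Fin n)) (hU : U.card = m) :
    MvPolynomial.eval (fun k => if k ∈ Finset.univ.image a ∪ Z then (1 : ℂ) else 0)
      (List.foldl (fun (q : MvPolynomial (Fin n) ℂ) i => pderiv (a i) q - pderiv (b i) q)
        (∏ k ∈ U, X k) (List.finRange j)) =
      if U = Finset.univ.image a ∪ Finset.univ.image b ∪ Z then ((-1 : ℤ) ^ j) • (1 : ℂ) else 0 := by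
  classical
  -- the mixed tuples are injective
  have hinj : ∀ ε : Fin j → Bool, Function.Injective fun i => if ε i then b i else a i := by
    intro ε i i' h
    dsimp only at h
    split_ifs at h with h1 h2 h2
    · exact hb h
    · exact absurd h.symm (hab i' i)
    · exact absurd h (hab i i')
    · exact ha h
  -- cardinalities
  have hca : (Finset.univ.image a).card = j := by
    rw [Finset.card_image_of_injective _ ha, Finset.card_univ, Fintype.card_fin]
  have hcε : ∀ ε : Fin j → Bool, (Finset.univ.image fun i => if ε i then b i else a i).card = j := by
    intro ε; rw [Finset.card_image_of_injective _ (hinj ε), Finset.card_univ, Fintype.card_fin]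
  have hdaZ : Disjoint (Finset.univ.image a) Z := by
    rw [Finset.disjoint_left]; intro k hk
    obtain ⟨i, -, rfl⟩ := Finset.mem_image.1 hk; exact hZa i
  have hcT : (Finset.univ.image a ∪ Z).card = j + Z.card := by
    rw [Finset.card_union_of_disjoint hdaZ, hca]
  set T : Finset (Fin n) := Finset.univ.image a ∪ Z with hT
  set R : Finset (Fin n) := Finset.univ.image a ∪ Finset.univ.image b ∪ Z with hR
  -- the value of one summand of the bool-expansion
  have hterm : ∀ ε : Fin j → Bool,
      MvPolynomial.eval (fun k => if k ∈ T then (1 : ℂ) else 0)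
        (List.foldl (fun (q : MvPolynomial (Fin n) ℂ) i => pderiv ((fun i => if ε i then b i else a i) i) q)
          (∏ k ∈ U, X k) (List.finRange j)) =
        if (ε = fun _ => true) ∧ U = R then 1 else 0 := by
    intro ε
    rw [pderivFold_prod_X_eq_ite j _ (hinj ε) U]
    by_cases hin : ∀ i, (fun i => if ε i then b i else a i) i ∈ U
    · rw [if_pos hin, eval_indicator_prod_X _ T _ (fun k hk => by simp only [hk, if_true])
        (fun k hk => by simp only [hk, if_false])]
      -- `U \ im c_ε` has `j + |Z|` elements
      have hsub : (Finset.univ.image fun i => if ε i then b i else a i) ⊆ U := by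
        intro k hk; obtain ⟨i, -, rfl⟩ := Finset.mem_image.1 hk; exact hin i
      have hcard : (U \ Finset.univ.image fun i => if ε i then b i else a i).card = j + Z.card := by
        rw [Finset.card_sdiff_of_subset hsub, hcε ε, hU]; omega
      by_cases hWT : (U \ Finset.univ.image fun i => if ε i then b i else a i) ⊆ T
      · -- then `U \ im c_ε = T`, so `c_ε = b` and `U = R`
        have hWeq : (U \ Finset.univ.image fun i => if ε i then b i else a i) = T :=
          Finset.eq_of_subset_of_card_le hWT (by rw [hcT, hcard])
        have hεt : ε = fun _ => true := by
          funext i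
          by_contra hεi
          have hεi' : ε i = false := by simpa using hεi
          have haU : a i ∈ (Finset.univ.image fun i => if ε i then b i else a i) :=
            Finset.mem_image.2 ⟨i, Finset.mem_univ _, by simp [hεi']⟩
          have haT : a i ∈ T := Finset.mem_union_left _ (Finset.mem_image_of_mem _ (Finset.mem_univ i))
          rw [← hWeq] at haT
          exact (Finset.mem_sdiff.1 haT).2 haU
        subst hεt
        have himb : (Finset.univ.image fun i => if (fun _ : Fin j => true) i then b i else a i) = Finset.univ.image b := by
          simp
        rw [himb] at hWeq hsub
        have hUR : U = R := by
          ext k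
          have hk := Finset.ext_iff.1 hWeq k
          simp only [Finset.mem_sdiff, hT, Finset.mem_union] at hk
          rw [hR]
          simp only [Finset.mem_union]
          constructor
          · intro hkU
            by_cases hkb : k ∈ Finset.univ.image b
            · exact Or.inl (Or.inr hkb)
            · rcases hk.1 ⟨hkU, hkb⟩ with hka | hkZ
              · exact Or.inl (Or.inl hka)
              · exact Or.inr hkZ
          · rintro ((hka | hkb) | hkZ)
            · exact (hk.2 (Or.inl hka)).1
            · exact hsub hkb
            · exact (hk.2 (Or.inr hkZ)).1
        rw [if_pos hWT, if_pos ⟨rfl, hUR⟩]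
      · rw [if_neg hWT, if_neg]
        rintro ⟨hεt, hUR⟩
        apply hWT
        subst hεt
        intro k hk
        rw [Finset.mem_sdiff] at hk
        obtain ⟨hkU, hkc⟩ := hk
        rw [hUR, hR] at hkU
        simp only [Finset.mem_union] at hkU
        rcases hkU with (hka | hkb) | hkZ
        · exact Finset.mem_union_left _ hka
        · exact absurd (by simpa using hkb) hkc
        · exact Finset.mem_union_right _ hkZ
    · rw [if_neg hin, map_zero, if_neg]
      rintro ⟨hεt, hUR⟩
      apply hin
      intro i
      subst hεt
      simp only [if_true]
      rw [hUR, hR]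
      exact Finset.mem_union_left _ (Finset.mem_union_right _ (Finset.mem_image_of_mem _ (Finset.mem_univ i)))
  -- sum the bool-expansion
  rw [deltaFold_eq_sum_bool, map_sum]
  simp_rw [map_zsmul]
  rw [Finset.sum_eq_single (fun _ => true)]
  · rw [hterm]
    by_cases hUR : U = R
    · rw [if_pos ⟨rfl, hUR⟩, if_pos hUR]
      congr 2
      simp
    · rw [if_neg (fun h => hUR h.2), if_neg hUR, smul_zero]
  · intro ε _ hne
    rw [hterm ε, if_neg (fun h => hne h.1), smul_zero]
  · intro h; exact absurd (Finset.mem_univ _) h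

/-! ### The Δ-witness for the embedding sum `S_{n,m} = Σ_{g : Fin m ↪ Fin n} Π_i y_{g i}` -/

/-- **`Δ_{a,b} S_{n,m} ≠ 0`** for `j` disjoint pairs and `m = 2j + |Z|` with `Z` avoiding the pairs (so `m ≤ n` is witnessed by
`im a ∪ im b ∪ Z`): at the indicator of `im a ∪ Z` the derivative evaluates to `(-1)^j · #{g : im g = im a ∪ im b ∪ Z}`, and the
increasing enumeration of that set is such a `g`. [folklore] -/
theorem deltaFold_embSum_ne_zero {n j m : ℕ} (a b : Fin j → Fin n) (ha : Function.Injective a)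
    (hb : Function.Injective b) (hab : ∀ i i', a i ≠ b i') (Z : Finset (Fin n)) (hZa : ∀ i, a i ∉ Z)
    (hZb : ∀ i, b i ∉ Z) (hm : 2 * j + Z.card = m) :
    List.foldl (fun (q : MvPolynomial (Fin n) ℂ) i => pderiv (a i) q - pderiv (b i) q)
      (∑ g : (Fin m ↪ Fin n), ∏ i : Fin m, X (g i)) (List.finRange j) ≠ 0 := by
  classical
  set R : Finset (Fin n) := Finset.univ.image a ∪ Finset.univ.image b ∪ Z with hR
  -- `|R| = m`
  have hdaZ : Disjoint (Finset.univ.image a) Z := by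
    rw [Finset.disjoint_left]; intro k hk
    obtain ⟨i, -, rfl⟩ := Finset.mem_image.1 hk; exact hZa i
  have hdbZ : Disjoint (Finset.univ.image b) Z := by
    rw [Finset.disjoint_left]; intro k hk
    obtain ⟨i, -, rfl⟩ := Finset.mem_image.1 hk; exact hZb i
  have hdab : Disjoint (Finset.univ.image a) (Finset.univ.image b) := by
    rw [Finset.disjoint_left]; intro k hk hk'
    obtain ⟨i, -, rfl⟩ := Finset.mem_image.1 hk
    obtain ⟨i', -, h⟩ := Finset.mem_image.1 hk'
    exact hab i i' h.symm
  have hRcard : R.card = m := by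
    rw [hR, Finset.card_union_of_disjoint (Finset.disjoint_union_left.2 ⟨hdaZ, hdbZ⟩),
      Finset.card_union_of_disjoint hdab, Finset.card_image_of_injective _ ha, Finset.card_image_of_injective _ hb,
      Finset.card_univ, Fintype.card_fin]
    omega
  -- each summand is a square-free monomial over the range
  have hprod : ∀ g : Fin m ↪ Fin n,
      (∏ i : Fin m, (X (g i) : MvPolynomial (Fin n) ℂ)) = ∏ k ∈ Finset.univ.map g, X k := by
    intro g; rw [Finset.prod_map]
  have hUcard : ∀ g : Fin m ↪ Fin n, (Finset.univ.map g).card = m := by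
    intro g; rw [Finset.card_map, Finset.card_univ, Fintype.card_fin]
  intro h0
  have h1 := congrArg (MvPolynomial.eval (fun k => if k ∈ Finset.univ.image a ∪ Z then (1 : ℂ) else 0)) h0
  rw [deltaFoldList_sum, map_sum, map_zero] at h1
  simp_rw [hprod] at h1
  rw [Finset.sum_congr rfl (fun g _ => eval_deltaFold_prod_X a b ha hb hab Z hZa hm _ (hUcard g)),
    ← Finset.sum_filter, Finset.sum_const] at h1
  -- the filter is nonempty: the increasing enumeration of `R`
  have hg₀ : (Finset.univ.filter fun g : Fin m ↪ Fin n => Finset.univ.map g = R).Nonempty := by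
    refine ⟨(R.orderEmbOfFin hRcard).toEmbedding, Finset.mem_filter.2 ⟨Finset.mem_univ _, ?_⟩⟩
    apply Finset.eq_of_subset_of_card_le
    · intro k hk
      obtain ⟨i, -, rfl⟩ := Finset.mem_map.1 hk
      exact Finset.orderEmbOfFin_mem R hRcard i
    · rw [hRcard, Finset.card_map, Finset.card_univ, Fintype.card_fin]
  have hN : (Finset.univ.filter fun g : Fin m ↪ Fin n => Finset.univ.map g = R).card ≠ 0 :=
    Finset.card_ne_zero.2 hg₀
  rw [smul_eq_zero] at h1
  rcases h1 with h1 | h1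
  · exact hN h1
  · rw [smul_eq_zero] at h1
    rcases h1 with h1 | h1
    · exact (pow_ne_zero j (by norm_num : (-1 : ℤ) ≠ 0)) h1
    · exact one_ne_zero h1

/-! ### The ordered partial-matching polynomial: symmetry, shadow, homogeneity -/

/-- **Matrix symmetry of `M_{n,m} = Σ_{g,h : Fin m ↪ Fin n} Π_i x_{(g i, h i)}`** (post-composition with `σ`, `τ` permutes the
embeddings). [folklore] -/
theorem rename_perm_embSum₂ (n m : ℕ) (σ τ : Equiv.Perm (Fin n)) :
    rename (fun p : Fin n × Fin n => (σ p.1, τ p.2))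
      (∑ g : (Fin m ↪ Fin n), ∑ h : (Fin m ↪ Fin n), ∏ i : Fin m, (X (g i, h i) : MvPolynomial (Fin n × Fin n) ℂ)) =
      ∑ g : (Fin m ↪ Fin n), ∑ h : (Fin m ↪ Fin n), ∏ i : Fin m, X (g i, h i) := by
  simp only [map_sum, map_prod, rename_X]
  -- reindex `g ↦ g.trans σ`, `h ↦ h.trans τ`
  have hσ : Function.Bijective fun g : Fin m ↪ Fin n => g.trans σ.toEmbedding := by
    refine (Finite.injective_iff_bijective).1 fun g g' hgg' => ?_
    apply DFunLike.coe_injective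
    funext i
    have := congrArg (fun e : Fin m ↪ Fin n => e i) hgg'
    simpa using this
  have hτ : Function.Bijective fun h : Fin m ↪ Fin n => h.trans τ.toEmbedding := by
    refine (Finite.injective_iff_bijective).1 fun h h' hhh' => ?_
    apply DFunLike.coe_injective
    funext i
    have := congrArg (fun e : Fin m ↪ Fin n => e i) hhh'
    simpa using this
  symm
  rw [← Function.Bijective.sum_comp hσ]
  refine Finset.sum_congr rfl fun g _ => ?_
  rw [← Function.Bijective.sum_comp hτ]
  refine Finset.sum_congr rfl fun h _ => ?_
  rfl

/-- **The symmetric shadow**: `rename fst M_{n,m} = |Fin m ↪ Fin n| • S_{n,m}` with `S_{n,m} = Σ_g Π_i y_{g i}`. [folklore] -/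
theorem rename_fst_embSum₂ (n m : ℕ) :
    rename (Prod.fst : Fin n × Fin n → Fin n)
      (∑ g : (Fin m ↪ Fin n), ∑ h : (Fin m ↪ Fin n), ∏ i : Fin m, (X (g i, h i) : MvPolynomial (Fin n × Fin n) ℂ)) =
      (Fintype.card (Fin m ↪ Fin n) : ℂ) • ∑ g : (Fin m ↪ Fin n), ∏ i : Fin m, X (g i) := by
  simp only [map_sum, map_prod, rename_X]
  rw [Finset.smul_sum]
  refine Finset.sum_congr rfl fun g _ => ?_
  rw [Finset.sum_const, Finset.card_univ, ← Nat.cast_smul_eq_nsmul ℂ]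

/-- `S_{n,m}` is homogeneous of degree `m`. [folklore] -/
theorem isHomogeneous_embSum (n m : ℕ) :
    (∑ g : (Fin m ↪ Fin n), ∏ i : Fin m, (X (g i) : MvPolynomial (Fin n) ℂ)).IsHomogeneous m := by
  refine IsHomogeneous.sum _ _ _ fun g _ => ?_
  have h := IsHomogeneous.prod (Finset.univ : Finset (Fin m)) (fun i : Fin m => (X (g i) : MvPolynomial (Fin n) ℂ))
    (fun _ => 1) (fun i _ => isHomogeneous_X ℂ (g i))
  simpa using h

/-! ### The lower bound -/

/-- **LOWER BOUND FOR AFFINE COLUMN-SET-MULTILINEAR `ΣΠΣ` CIRCUITS COMPUTING THE ORDERED PARTIAL-MATCHING POLYNOMIAL.**  If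
`M_{n,m} = Σ_{g,h : Fin m ↪ Fin n} Π_i x_{(g i, h i)}` (`= m!·` the sub-permanent sum of order `m`) equals an affine column-sml
expression `Σ_{t<s} Π_{b<n} (β_{t,b} + Σ_a α_{t,b,a} x_{(a,b)})`, then `s ≥ C(n-j, j)` for every `j` with `2j ≤ m ≤ n`.
[folklore] -/
theorem subPermanent_affineColSml_lower_bound {n m s j : ℕ} (h2j : 2 * j ≤ m) (hmn : m ≤ n) (β : Fin s → Fin n → ℂ)
    (α : Fin s → Fin n → Fin n → ℂ)
    (hM : (∑ t : Fin s, ∏ b : Fin n, (C (β t b) + ∑ a : Fin n, C (α t b a) * X (a, b)) :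
      MvPolynomial (Fin n × Fin n) ℂ) =
      ∑ g : (Fin m ↪ Fin n), ∑ h : (Fin m ↪ Fin n), ∏ i : Fin m, X (g i, h i)) :
    Nat.choose (n - j) j ≤ s := by
  classical
  have hrow : ∀ σ : Equiv.Perm (Fin n), rename (fun v : Fin n × Fin n => (σ v.1, v.2))
      (∑ t : Fin s, ∏ b : Fin n, (C (β t b) + ∑ a : Fin n, C (α t b a) * X (a, b)) :
        MvPolynomial (Fin n × Fin n) ℂ) =
      ∑ t : Fin s, ∏ b : Fin n, (C (β t b) + ∑ a : Fin n, C (α t b a) * X (a, b)) := by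
    intro σ; rw [hM]; simpa using rename_perm_embSum₂ n m σ 1
  have hcol : ∀ τ : Equiv.Perm (Fin n), rename (fun v : Fin n × Fin n => (v.1, τ v.2))
      (∑ t : Fin s, ∏ b : Fin n, (C (β t b) + ∑ a : Fin n, C (α t b a) * X (a, b)) :
        MvPolynomial (Fin n × Fin n) ℂ) =
      ∑ t : Fin s, ∏ b : Fin n, (C (β t b) + ∑ a : Fin n, C (α t b a) * X (a, b)) := by
    intro τ; rw [hM]; simpa using rename_perm_embSum₂ n m 1 τ
  -- the disjoint pairs `(2i, 2i+1)` and the block `Z = {2j, …, m-1}`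
  let a : Fin j → Fin n := fun i => ⟨2 * (i : ℕ), by omega⟩
  let b : Fin j → Fin n := fun i => ⟨2 * (i : ℕ) + 1, by omega⟩
  have ha : Function.Injective a := by
    intro i i' h; simp only [a, Fin.mk.injEq] at h; exact Fin.ext (by omega)
  have hb : Function.Injective b := by
    intro i i' h; simp only [b, Fin.mk.injEq] at h; exact Fin.ext (by omega)
  have hab : ∀ i i', a i ≠ b i' := by
    intro i i' h; simp only [a, b, Fin.mk.injEq] at h; omega
  let Z : Finset (Fin n) := Finset.univ.filter fun k : Fin n => 2 * j ≤ (k : ℕ) ∧ (k : ℕ) < m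
  have hZa : ∀ i, a i ∉ Z := by
    intro i hi; simp only [Z, a, Finset.mem_filter, Finset.mem_univ, true_and] at hi; omega
  have hZb : ∀ i, b i ∉ Z := by
    intro i hi; simp only [Z, b, Finset.mem_filter, Finset.mem_univ, true_and] at hi; omega
  have hZcard : Z.card = m - 2 * j := by
    -- `Z` is the image of `Fin (m - 2j)` under `i ↦ 2j + i`
    have hZeq : Z = (Finset.univ : Finset (Fin (m - 2 * j))).image
        (fun i : Fin (m - 2 * j) => (⟨2 * j + (i : ℕ), by omega⟩ : Fin n)) := by
      ext k
      simp only [Z, Finset.mem_filter, Finset.mem_univ, true_and, Finset.mem_image]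
      constructor
      · rintro ⟨h1, h2⟩
        exact ⟨⟨(k : ℕ) - 2 * j, by omega⟩, Fin.ext (by simp; omega)⟩
      · rintro ⟨i, rfl⟩
        simp; omega
    rw [hZeq, Finset.card_image_of_injective _ (fun i i' h => by
      simp only [Fin.mk.injEq] at h; exact Fin.ext (by omega)), Finset.card_univ, Fintype.card_fin]
  have hm : 2 * j + Z.card = m := by rw [hZcard]; omega
  refine affineColSml_lower_bound_of_deltaWitness (by omega) β α hrow hcol a b ha hb hab m ?_
  rw [hM, rename_fst_embSum₂, map_smul,
    homogeneousComponent_of_mem ((mem_homogeneousSubmodule m _).2 (isHomogeneous_embSum n m)), if_pos rfl,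
    deltaFoldList_smul]
  have hcard : (Fintype.card (Fin m ↪ Fin n) : ℂ) ≠ 0 := by
    have : 0 < Fintype.card (Fin m ↪ Fin n) :=
      Fintype.card_pos_iff.2 ⟨(Fin.castLEEmb hmn)⟩
    exact_mod_cast this.ne'
  exact smul_ne_zero hcard (deltaFold_embSum_ne_zero a b ha hb hab Z hZa hZb hm)

end Summit.ValiantsHypothesis.ValiantsHypothesis.Theorems.SmlAffinePermanent

end
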